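import Mathlib
import Literature.Analysis.ODE.InverseSquareRecessive
import Literature.Analysis.ODE.InverseSquareDominant
import Literature.Analysis.ODE.InverseSquareTrueChain
import HarnessLib

/-!
# The true chains from the potential alone (recessive + dominant + perturbation), at scale `8`

Analysis/ODE support file (everything proved). `true_chain_at_scale`: for a continuous potential
`Q` of inverse-square type beyond `3`, `Q w = n(n+1)/w² + q w`, `|q w| ≤ ε w^{-5/2}` (`w ≥ 3`),
`ε ≤ 1/16`, the full hypotheses of `exists_true_chain` (`InverseSquareTrueChain.lean`) are met with
`B = 4`: the recessive solution of `InverseSquareRecessive.lean` (`A = 3`, tails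
`∫_w^∞ s|q| ≤ 2ε w^{-1/2}`), the dominant one of `InverseSquareDominant.lean` (`η = 8ε ≤ ½`), and
the conversions to real-power bounds (`c_U = 3/2`, `c_U' = (3n+1)/2`, `K_U = 8 + 8n`). Hence the
true chains `a_0,…,a_j` exist on `(4, ∞)`. `exists_true_chain_scaled` transports them to the unit
scale: for `P` of inverse-square type beyond `3/8` the functions `z ↦ 8^{n−2j} a_i(8z)` form a chain
for `P` on `(½, ∞)` with couplings `64 μ_i` — exactly what the `t`-polynomial kernel elements of the
far-side channel estimate need (route PhotonSphereChannels, `FixedModeChannels`,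
stmt-FinalStateConjecture-10048). Folklore.
-/

noncomputable section

namespace Literature.Analysis.ODE

open MeasureTheory Set Filter Topology Real

/-- **True chains at scale `8`.** See the module docstring. [folklore] -/
theorem true_chain_at_scale (n : ℕ) {μ : ℕ → ℝ} (hμ : ∀ i, μ i ≠ 0) {j : ℕ} (hj : 2 * j ≤ n) :
    ∃ K : ℝ, 0 ≤ K ∧ ∀ {Q q : ℝ → ℝ} {ε : ℝ}, Continuous Q → Continuous q → 0 ≤ ε → ε ≤ 1 / 16 →
      (∀ w, 3 ≤ w → Q w = (n : ℝ) * (n + 1) / w ^ 2 + q w) →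
      (∀ w, 3 ≤ w → |q w| ≤ ε * w ^ (-(5 : ℝ) / 2)) →
    ∃ (a a' : ℕ → ℝ → ℝ) (c : ℕ → ℝ), c 0 = 1 ∧ (∀ w, a (j + 1) w = 0) ∧
      (∀ i, i ≤ j → Continuous (a i)) ∧
      (∀ i, i ≤ j → ∀ w, 4 < w →
        HasDerivAt (a i) (a' i w) w ∧ HasDerivAt (a' i) (Q w * a i w + μ i * a (i + 1) w) w) ∧
      (∀ i, i ≤ j → ∀ w, 4 ≤ w →
        |a i w - c i * w ^ ((2 * j : ℝ) - n - 2 * i)|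
            ≤ K * ε * w ^ ((2 * j : ℝ) - n - 2 * i - 1 / 2) ∧
        |a' i w - c i * ((2 * j : ℝ) - n - 2 * i) * w ^ ((2 * j : ℝ) - n - 2 * i - 1)|
          ≤ K * ε * w ^ ((2 * j : ℝ) - n - 2 * i - 3 / 2)) ∧
      (∀ i, i ≤ j → |c i| ≤ K) := by
  obtain ⟨K, hK0, hK⟩ := exists_true_chain n hμ hj (cU := 3 / 2) (cU' := (3 * n + 1) / 2)
    (KU := 8 + 8 * n) (by norm_num) (by positivity) (by positivity)
  refine ⟨K, hK0, ?_⟩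
  intro Q q ε hQc hq hε hε1 hQq hqb
  -- integrability and tails of `s |q s|` beyond `3`
  have hsq : ∀ s, 3 ≤ s → s * |q s| ≤ ε * s ^ (-(3 : ℝ) / 2) := by
    intro s hs
    have hs0 : 0 < s := by linarith
    calc s * |q s| ≤ s * (ε * s ^ (-(5 : ℝ) / 2)) := mul_le_mul_of_nonneg_left (hqb s hs) hs0.le
      _ = ε * (s ^ (1 : ℝ) * s ^ (-(5 : ℝ) / 2)) := by rw [rpow_one]; ring
      _ = ε * s ^ (-(3 : ℝ) / 2) := by rw [← rpow_add hs0]; norm_num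
  have hqi : IntegrableOn (fun s => s * |q s|) (Ioi 3) :=
    Integrable.mono' ((integrableOn_Ioi_rpow_of_lt (by norm_num : (-(3 : ℝ) / 2) < -1)
      (by norm_num : (0 : ℝ) < 3)).const_mul ε)
      ((continuous_id.mul hq.abs).aestronglyMeasurable)
      ((ae_restrict_iff' measurableSet_Ioi).2 (ae_of_all _ fun s hs => by
        have hs' : 3 ≤ s := le_of_lt hs
        have hs0 : 0 ≤ s := by linarith
        rw [Real.norm_eq_abs, abs_of_nonneg (mul_nonneg hs0 (abs_nonneg _))]
        exact hsq s hs'))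
  have htail : ∀ w, 3 ≤ w → (∫ s in Ioi w, s * |q s|) ≤ 2 * ε * w ^ (-(1 : ℝ) / 2) := by
    intro w hw
    have hw0 : 0 < w := by linarith
    calc (∫ s in Ioi w, s * |q s|) ≤ ∫ s in Ioi w, ε * s ^ (-(3 : ℝ) / 2) :=
          setIntegral_mono_on (hqi.mono_set (Ioi_subset_Ioi hw))
            ((integrableOn_Ioi_rpow_of_lt (by norm_num) hw0).const_mul ε) measurableSet_Ioi
            fun s hs => hsq s (hw.trans (le_of_lt hs))
      _ = ε * (-w ^ (-(3 : ℝ) / 2 + 1) / (-(3 : ℝ) / 2 + 1)) := by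
          rw [MeasureTheory.integral_const_mul, integral_Ioi_rpow_of_lt (by norm_num) hw0]
      _ = 2 * ε * w ^ (-(1 : ℝ) / 2) := by norm_num; ring
  have htail1 : ∀ w, 3 ≤ w → (∫ s in Ioi w, s * |q s|) ≤ 2 * ε := by
    intro w hw
    have h1 : w ^ (-(1 : ℝ) / 2) ≤ 1 := rpow_le_one_of_one_le_of_nonpos (by linarith) (by norm_num)
    calc (∫ s in Ioi w, s * |q s|) ≤ 2 * ε * w ^ (-(1 : ℝ) / 2) := htail w hw
      _ ≤ 2 * ε * 1 := mul_le_mul_of_nonneg_left h1 (by positivity)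
      _ = 2 * ε := mul_one _
  -- recessive and dominant solutions
  obtain ⟨U, hU, hU0, hU1⟩ := exists_isSchrodingerSol_inverseSquare_recessive (n := n) hq
    (by norm_num : (1 : ℝ) ≤ 3) hqi hQc hQq (by linarith [htail1 3 le_rfl])
  have hη : 8 * ε ≤ 1 / 2 := by linarith
  have hU0' : ∀ w, 3 < w → |w ^ n * U w - 1| ≤ 8 * ε := fun w hw =>
    (hU0 w hw).trans (by linarith [htail1 w hw.le])
  have hU1' : ∀ w, 3 < w → |w ^ (n + 1) * deriv U w + n * (w ^ n * U w)| ≤ 8 * ε := fun w hw =>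
    (hU1 w hw).trans (by linarith [htail1 w hw.le])
  obtain ⟨V, hV, hW, hVb, hV'b⟩ := exists_dominant_of_recessive hQc hU
    (by norm_num : (1 : ℝ) ≤ 3) hη hU0' hU1'
  have hpt := fun w (hw : (3 : ℝ) < w) =>
    recessive_pointwise_bounds (U := U) (by norm_num : (1:ℝ) ≤ 3) hη hU0' hU1' hw
  -- conversions to real powers beyond `4`
  have hrp : ∀ {w : ℝ}, 0 < w → ∀ k : ℕ, w ^ (k : ℝ) = w ^ k := fun _ k => rpow_natCast _ k
  have hUb : ∀ w, 4 ≤ w → |U w| ≤ 3 / 2 * w ^ (-(n : ℝ)) := by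
    intro w hw
    have hw0 : 0 < w := by linarith
    obtain ⟨hUp, -, hhi, -⟩ := hpt w (by linarith)
    rw [abs_of_pos hUp, rpow_neg hw0.le, hrp hw0, ← div_eq_mul_inv, le_div_iff₀ (pow_pos hw0 n)]
    linarith
  have hU'b : ∀ w, 4 ≤ w → |deriv U w| ≤ (3 * n + 1) / 2 * w ^ (-(n : ℝ) - 1) := by
    intro w hw
    have hw0 : 0 < w := by linarith
    obtain ⟨-, -, -, hd⟩ := hpt w (by linarith)
    rw [show -(n : ℝ) - 1 = -((n + 1 : ℕ) : ℝ) by push_cast; ring, rpow_neg hw0.le, hrp hw0]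
    exact hd
  have hVb' : ∀ w, 4 ≤ w → |V w| ≤ 6 * w ^ ((n : ℝ) + 1) := by
    intro w hw
    have hw0 : 0 < w := by linarith
    rw [show (n : ℝ) + 1 = ((n + 1 : ℕ) : ℝ) by push_cast; ring, hrp hw0]
    exact hVb w (by norm_num; exact hw)
  have hV'b' : ∀ w, 4 ≤ w → |deriv V w| ≤ 5 * w ^ (n : ℝ) := by
    intro w hw
    have hw0 : 0 < w := by linarith
    rw [hrp hw0]; exact hV'b w (by norm_num; exact hw)
  have hUrec : ∀ w, 4 ≤ w → |U w - w ^ (-(n : ℝ))| ≤ (8 + 8 * n) * ε * w ^ (-(n : ℝ) - 1 / 2) := by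
    intro w hw
    have hw0 : 0 < w := by linarith
    have hwn : 0 < w ^ n := pow_pos hw0 n
    have h0 := (hU0 w (by linarith)).trans (by linarith [htail w (by linarith)] :
      4 * ∫ s in Ioi w, s * |q s| ≤ 8 * ε * w ^ (-(1 : ℝ) / 2))
    have e : U w - w ^ (-(n : ℝ)) = (w ^ n)⁻¹ * (w ^ n * U w - 1) := by
      rw [rpow_neg hw0.le, hrp hw0]; field_simp
    rw [e, abs_mul, abs_of_pos (inv_pos.2 hwn)]
    calc (w ^ n)⁻¹ * |w ^ n * U w - 1| ≤ (w ^ n)⁻¹ * (8 * ε * w ^ (-(1 : ℝ) / 2)) :=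
          mul_le_mul_of_nonneg_left h0 (by positivity)
      _ = 8 * ε * w ^ (-(n : ℝ) - 1 / 2) := by
          rw [show -(n : ℝ) - 1 / 2 = -(n : ℝ) + (-(1 : ℝ) / 2) by ring, rpow_add hw0,
            rpow_neg hw0.le, hrp hw0]; ring
      _ ≤ (8 + 8 * n) * ε * w ^ (-(n : ℝ) - 1 / 2) := by
          have : (0 : ℝ) ≤ n := n.cast_nonneg
          gcongr; linarith
  have hU'rec : ∀ w, 4 ≤ w →
      |deriv U w + n * w ^ (-(n : ℝ) - 1)| ≤ (8 + 8 * n) * ε * w ^ (-(n : ℝ) - 3 / 2) := by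
    intro w hw
    have hw0 : 0 < w := by linarith
    have hwn : 0 < w ^ (n + 1) := pow_pos hw0 _
    have h1 := (hU1 w (by linarith)).trans (by linarith [htail w (by linarith)] :
      2 * ∫ s in Ioi w, s * |q s| ≤ 4 * ε * w ^ (-(1 : ℝ) / 2))
    have h0 := (hU0 w (by linarith)).trans (by linarith [htail w (by linarith)] :
      4 * ∫ s in Ioi w, s * |q s| ≤ 8 * ε * w ^ (-(1 : ℝ) / 2))
    have e : deriv U w + n * w ^ (-(n : ℝ) - 1)
        = (w ^ (n + 1))⁻¹
          * ((w ^ (n + 1) * deriv U w + n * (w ^ n * U w)) - n * (w ^ n * U w - 1)) := by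
      rw [show -(n : ℝ) - 1 = -((n + 1 : ℕ) : ℝ) by push_cast; ring, rpow_neg hw0.le, hrp hw0]
      field_simp; ring
    rw [e, abs_mul, abs_of_pos (inv_pos.2 hwn)]
    have hn0 : (0 : ℝ) ≤ n := n.cast_nonneg
    have key : |(w ^ (n + 1) * deriv U w + n * (w ^ n * U w)) - n * (w ^ n * U w - 1)|
        ≤ (4 + 8 * n) * ε * w ^ (-(1 : ℝ) / 2) := by
      calc |(w ^ (n + 1) * deriv U w + n * (w ^ n * U w)) - n * (w ^ n * U w - 1)|
          ≤ |w ^ (n + 1) * deriv U w + n * (w ^ n * U w)| + |(n : ℝ) * (w ^ n * U w - 1)| :=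
            abs_sub _ _
        _ ≤ 4 * ε * w ^ (-(1 : ℝ) / 2) + n * (8 * ε * w ^ (-(1 : ℝ) / 2)) := by
            refine add_le_add h1 ?_
            rw [abs_mul, abs_of_nonneg hn0]
            exact mul_le_mul_of_nonneg_left h0 hn0
        _ = (4 + 8 * n) * ε * w ^ (-(1 : ℝ) / 2) := by ring
    calc (w ^ (n + 1))⁻¹ * |(w ^ (n + 1) * deriv U w + n * (w ^ n * U w)) - n * (w ^ n * U w - 1)|
        ≤ (w ^ (n + 1))⁻¹ * ((4 + 8 * n) * ε * w ^ (-(1 : ℝ) / 2)) :=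
          mul_le_mul_of_nonneg_left key (by positivity)
      _ = (4 + 8 * n) * ε * w ^ (-(n : ℝ) - 3 / 2) := by
          rw [show -(n : ℝ) - 3 / 2 = -((n + 1 : ℕ) : ℝ) + (-(1 : ℝ) / 2) by push_cast; ring,
            rpow_add hw0, rpow_neg hw0.le, hrp hw0]; ring
      _ ≤ (8 + 8 * n) * ε * w ^ (-(n : ℝ) - 3 / 2) := by gcongr; linarith
  exact hK hU hV hW (by norm_num : (1 : ℝ) ≤ 4) hε hUb hU'b hVb' hV'b' hq
    (fun w hw => hQq w (by linarith)) (fun w hw => hqb w (by linarith)) hUrec hU'rec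

/-- **True chains at the unit scale.** For `P` of inverse-square type beyond `3/8`
(`|q z| ≤ ε z^{-5/2}`, `ε ≤ 1/64`) and couplings `m_i ≠ 0` there are chains `a_0, …, a_j` for `P` on
`(½, ∞)`: `a_i'' = P a_i + m_i a_{i+1}`, `|a_i − c_i z^{2j−n−2i}| ≤ K ε z^{2j−n−2i−1/2}` etc. for
`z ≥ ½` (transport of `true_chain_at_scale` by `z = w/8`). [folklore] -/
theorem exists_true_chain_scaled (n : ℕ) {m : ℕ → ℝ} (hm : ∀ i, m i ≠ 0) {j : ℕ}
    (hj : 2 * j ≤ n) :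
    ∃ K : ℝ, 0 ≤ K ∧ ∀ {P q : ℝ → ℝ} {ε : ℝ}, Continuous P → Continuous q → 0 ≤ ε → ε ≤ 1 / 64 →
      (∀ z, 3 / 8 ≤ z → P z = (n : ℝ) * (n + 1) / z ^ 2 + q z) →
      (∀ z, 3 / 8 ≤ z → |q z| ≤ ε * z ^ (-(5 : ℝ) / 2)) →
    ∃ (a a' : ℕ → ℝ → ℝ) (c : ℕ → ℝ), c 0 = 1 ∧ (∀ z, a (j + 1) z = 0) ∧
      (∀ i, i ≤ j → Continuous (a i)) ∧
      (∀ i, i ≤ j → ∀ z, (1 / 2 : ℝ) < z →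
        HasDerivAt (a i) (a' i z) z ∧ HasDerivAt (a' i) (P z * a i z + m i * a (i + 1) z) z) ∧
      (∀ i, i ≤ j → ∀ z, (1 / 2 : ℝ) ≤ z →
        |a i z - c i * z ^ ((2 * j : ℝ) - n - 2 * i)|
            ≤ K * ε * z ^ ((2 * j : ℝ) - n - 2 * i - 1 / 2) ∧
        |a' i z - c i * ((2 * j : ℝ) - n - 2 * i) * z ^ ((2 * j : ℝ) - n - 2 * i - 1)|
          ≤ K * ε * z ^ ((2 * j : ℝ) - n - 2 * i - 3 / 2)) ∧
      (∀ i, i ≤ j → |c i| ≤ K) := by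
  obtain ⟨K, hK0, hK⟩ := true_chain_at_scale n (μ := fun i => m i / 64)
    (fun i => div_ne_zero (hm i) (by norm_num)) hj
  refine ⟨K, hK0, ?_⟩
  intro P q ε hPc hq hε hε1 hPq hqb
  -- the potential at scale `8`
  set Q : ℝ → ℝ := fun w => P (w / 8) / 64 with hQ
  set q₈ : ℝ → ℝ := fun w => q (w / 8) / 64 with hq₈
  have hQc : Continuous Q := (hPc.comp (continuous_id.div_const 8)).div_const 64
  have hq₈c : Continuous q₈ := (hq.comp (continuous_id.div_const 8)).div_const 64
  have h8 : (0 : ℝ) < 8 := by norm_num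
  have hQq : ∀ w, 3 ≤ w → Q w = (n : ℝ) * (n + 1) / w ^ 2 + q₈ w := by
    intro w hw
    have hw0 : w ≠ 0 := by linarith
    simp only [hQ, hq₈, hPq (w / 8) (by linarith)]
    field_simp
    ring
  set ε₈ : ℝ := Real.sqrt 8 * ε with hε₈
  have hsq8 : Real.sqrt 8 = (8 : ℝ) ^ ((1 : ℝ) / 2) := by rw [Real.sqrt_eq_rpow]
  have hsq8_le : Real.sqrt 8 ≤ 3 := by
    rw [show (3 : ℝ) = Real.sqrt 9 by
      rw [show (9:ℝ) = 3 ^ 2 by norm_num, Real.sqrt_sq (by norm_num)]]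
    exact Real.sqrt_le_sqrt (by norm_num)
  have hε₈0 : 0 ≤ ε₈ := by positivity
  have hε₈1 : ε₈ ≤ 1 / 16 := by
    simp only [hε₈]; nlinarith [Real.sqrt_nonneg 8]
  have hq₈b : ∀ w, 3 ≤ w → |q₈ w| ≤ ε₈ * w ^ (-(5 : ℝ) / 2) := by
    intro w hw
    have hw0 : 0 < w := by linarith
    have h := hqb (w / 8) (by linarith)
    simp only [hq₈, abs_div, abs_of_pos (by norm_num : (0:ℝ) < 64)]
    rw [div_le_iff₀ (by norm_num : (0:ℝ) < 64)]
    calc |q (w / 8)| ≤ ε * (w / 8) ^ (-(5 : ℝ) / 2) := h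
      _ = ε * ((8 : ℝ) ^ ((5 : ℝ) / 2) * w ^ (-(5 : ℝ) / 2)) := by
          rw [div_eq_mul_inv, mul_rpow hw0.le (by norm_num), inv_rpow h8.le, ← rpow_neg h8.le]
          ring_nf
      _ = ε₈ * w ^ (-(5 : ℝ) / 2) * 64 := by
          have : (8 : ℝ) ^ ((5 : ℝ) / 2) = (8 : ℝ) ^ ((1 : ℝ) / 2) * 64 := by
            rw [show (5 : ℝ) / 2 = 1 / 2 + 2 by norm_num, rpow_add h8, rpow_two]; norm_num
          rw [this, hε₈, hsq8]; ring
  obtain ⟨a₈, a₈', c₈, hc0, htop, hcont, hder, hbd, hcK⟩ := hK hQc hq₈c hε₈0 hε₈1 hQq hq₈b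
  -- transport to the unit scale
  set γ₀ : ℝ := (2 * j : ℝ) - n with hγ₀
  set C : ℝ := (8 : ℝ) ^ (-γ₀) with hC
  have hC0 : 0 < C := rpow_pos_of_pos h8 _
  set a : ℕ → ℝ → ℝ := fun i z => C * a₈ i (8 * z) with ha
  set a' : ℕ → ℝ → ℝ := fun i z => C * 8 * a₈' i (8 * z) with ha'
  set c : ℕ → ℝ := fun i => c₈ i * (8 : ℝ) ^ (-(2 * i : ℝ)) with hc
  have hpow_le : ∀ i : ℕ, (8 : ℝ) ^ (-(2 * i : ℝ)) ≤ 1 := fun i =>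
    rpow_le_one_of_one_le_of_nonpos (by norm_num) (by
      have : (0 : ℝ) ≤ i := Nat.cast_nonneg _; linarith)
  have hpow_pos : ∀ x : ℝ, 0 < (8 : ℝ) ^ x := fun x => rpow_pos_of_pos h8 _
  -- rescaling identities for the exponents
  have hscale : ∀ (i : ℕ) (z : ℝ), 0 < z → ∀ t : ℝ,
      C * (8 * z) ^ ((2 * j : ℝ) - n - 2 * i + t)
        = (8 : ℝ) ^ (-(2 * i : ℝ) + t) * z ^ ((2 * j : ℝ) - n - 2 * i + t) := by
    intro i z hz t
    rw [mul_rpow h8.le hz.le, hC, ← mul_assoc, ← rpow_add h8]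
    congr 1; simp only [hγ₀]; ring_nf
  refine ⟨a, a', c, by simp [hc, hc0], fun z => by simp [ha, htop], fun i hi => ?_,
    fun i hi z hz => ?_, fun i hi z hz => ?_, fun i hi => ?_⟩
  · exact continuous_const.mul ((hcont i hi).comp (continuous_const.mul continuous_id))
  · have hw : (4 : ℝ) < 8 * z := by linarith
    obtain ⟨h1, h2⟩ := hder i hi (8 * z) hw
    have hlin : HasDerivAt (fun z : ℝ => 8 * z) 8 z := by
      simpa using (hasDerivAt_id z).const_mul (8 : ℝ)
    constructor
    · have h := (h1.comp z hlin).const_mul C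
      refine h.congr_deriv ?_
      simp only [ha']; ring
    · have h := (h2.comp z hlin).const_mul (C * 8)
      refine h.congr_deriv ?_
      have hQz : Q (8 * z) = P z / 64 := by simp only [hQ]; ring_nf
      rw [hQz]
      simp only [ha]
      field_simp
      ring
  · have hz0 : 0 < z := by linarith
    have hw : (4 : ℝ) ≤ 8 * z := by linarith
    obtain ⟨b1, b2⟩ := hbd i hi (8 * z) hw
    have hKε : K * ε₈ * (8 : ℝ) ^ (-(2 * i : ℝ) + (-(1 : ℝ) / 2)) ≤ K * ε := by
      have e : ε₈ * (8 : ℝ) ^ (-(2 * i : ℝ) + (-(1 : ℝ) / 2)) = ε * (8 : ℝ) ^ (-(2 * i : ℝ)) := by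
        rw [hε₈, hsq8, rpow_add h8]
        have : (8 : ℝ) ^ ((1 : ℝ) / 2) * (8 : ℝ) ^ (-(1 : ℝ) / 2) = 1 := by
          rw [← rpow_add h8]; norm_num
        calc (8 : ℝ) ^ ((1 : ℝ) / 2) * ε * ((8 : ℝ) ^ (-(2 * i : ℝ)) * (8 : ℝ) ^ (-(1 : ℝ) / 2))
            = ε * (8 : ℝ) ^ (-(2 * i : ℝ))
              * ((8 : ℝ) ^ ((1 : ℝ) / 2) * (8 : ℝ) ^ (-(1 : ℝ) / 2)) := by
              ring
          _ = ε * (8 : ℝ) ^ (-(2 * i : ℝ)) := by rw [this, mul_one]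
      rw [mul_assoc, e, ← mul_assoc]
      calc K * ε * (8 : ℝ) ^ (-(2 * i : ℝ)) ≤ K * ε * 1 :=
            mul_le_mul_of_nonneg_left (hpow_le i) (by positivity)
        _ = K * ε := mul_one _
    have hKε' : K * ε₈ * (8 : ℝ) ^ (-(2 * i : ℝ) + (-(3 : ℝ) / 2)) * 8 ≤ K * ε := by
      have : (8 : ℝ) ^ (-(2 * i : ℝ) + (-(3 : ℝ) / 2)) * 8
          = (8 : ℝ) ^ (-(2 * i : ℝ) + (-(1 : ℝ) / 2)) := by
        rw [show -(2 * i : ℝ) + (-(1 : ℝ) / 2) = (-(2 * i : ℝ) + (-(3 : ℝ) / 2)) + 1 by ring,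
          rpow_add h8 (-(2 * i : ℝ) + (-(3 : ℝ) / 2)) 1, rpow_one]
      rw [mul_assoc (K * ε₈), this]; exact hKε
    constructor
    · have e : a i z - c i * z ^ ((2 * j : ℝ) - n - 2 * i)
          = C * (a₈ i (8 * z) - c₈ i * (8 * z) ^ ((2 * j : ℝ) - n - 2 * i)) := by
        have h := hscale i z hz0 0
        simp only [add_zero] at h
        simp only [ha, hc]
        linear_combination (c₈ i) * h
      rw [e, abs_mul, abs_of_pos hC0]
      calc C * |a₈ i (8 * z) - c₈ i * (8 * z) ^ ((2 * j : ℝ) - n - 2 * i)|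
          ≤ C * (K * ε₈ * (8 * z) ^ ((2 * j : ℝ) - n - 2 * i - 1 / 2)) :=
            mul_le_mul_of_nonneg_left b1 hC0.le
        _ = K * ε₈ * (C * (8 * z) ^ ((2 * j : ℝ) - n - 2 * i + (-(1 : ℝ) / 2))) := by ring_nf
        _ = (K * ε₈ * (8 : ℝ) ^ (-(2 * i : ℝ) + (-(1 : ℝ) / 2)))
            * z ^ ((2 * j : ℝ) - n - 2 * i - 1 / 2) := by rw [hscale i z hz0]; ring_nf
        _ ≤ K * ε * z ^ ((2 * j : ℝ) - n - 2 * i - 1 / 2) :=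
            mul_le_mul_of_nonneg_right hKε (rpow_nonneg hz0.le _)
    · have e : a' i z - c i * ((2 * j : ℝ) - n - 2 * i) * z ^ ((2 * j : ℝ) - n - 2 * i - 1)
          = C * 8 * (a₈' i (8 * z)
            - c₈ i * ((2 * j : ℝ) - n - 2 * i) * (8 * z) ^ ((2 * j : ℝ) - n - 2 * i - 1)) := by
        have h := hscale i z hz0 (-1)
        have h81 : (8 : ℝ) ^ (-(2 * i : ℝ) + -1) = (8 : ℝ) ^ (-(2 * i : ℝ)) / 8 := by
          rw [rpow_add h8, rpow_neg_one]; ring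
        rw [h81, ← sub_eq_add_neg] at h
        simp only [ha', hc]
        linear_combination (8 * c₈ i * ((2 * j : ℝ) - n - 2 * i)) * h
      rw [e, abs_mul, abs_of_pos (by positivity : (0:ℝ) < C * 8)]
      calc C * 8 * |a₈' i (8 * z)
            - c₈ i * ((2 * j : ℝ) - n - 2 * i) * (8 * z) ^ ((2 * j : ℝ) - n - 2 * i - 1)|
          ≤ C * 8 * (K * ε₈ * (8 * z) ^ ((2 * j : ℝ) - n - 2 * i - 3 / 2)) :=
            mul_le_mul_of_nonneg_left b2 (by positivity)
        _ = K * ε₈ * (C * (8 * z) ^ ((2 * j : ℝ) - n - 2 * i + (-(3 : ℝ) / 2))) * 8 := by ring_nf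
        _ = (K * ε₈ * (8 : ℝ) ^ (-(2 * i : ℝ) + (-(3 : ℝ) / 2)) * 8)
            * z ^ ((2 * j : ℝ) - n - 2 * i - 3 / 2) := by rw [hscale i z hz0]; ring_nf
        _ ≤ K * ε * z ^ ((2 * j : ℝ) - n - 2 * i - 3 / 2) :=
            mul_le_mul_of_nonneg_right hKε' (rpow_nonneg hz0.le _)
  · simp only [hc, abs_mul, abs_of_pos (hpow_pos _)]
    calc |c₈ i| * (8 : ℝ) ^ (-(2 * i : ℝ)) ≤ K * 1 :=
          mul_le_mul (hcK i hi) (hpow_le i) (hpow_pos _).le hK0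
      _ = K := mul_one _

end Literature.Analysis.ODE
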